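import Mathlib
import Summits.Ventures.PercRepro2.Tail2DBlockCalc
import Summits.Ventures.PercRepro2.Tail2DHarrisSP
import Summits.Ventures.PercRepro2.Tail2DFlowOneBlocks
import Summits.Ventures.PercRepro2.Tail2DFlowOneStep01
import Summits.Ventures.PercRepro2.Tail2DParFin
import Summits.Ventures.PercRepro2.Tail2DParFinTop
import Summits.Ventures.PercRepro2.Tail2DParFinDiag
import Summits.Ventures.PercRepro2.Tail2DParFinSubTopD
import Summits.Ventures.PercRepro2.Tail2DSDomSwap
import Summits.Ventures.PercRepro2.Tail2DAxisClass
import Summits.Ventures.PercRepro2.Tail2DFourIdent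
import Summits.Ventures.PercRepro2.Tail2DRelay20Comb
import Summits.Ventures.PercRepro2.Tail2DEig60Ident
import Summits.Ventures.PercRepro2.Tail2DEig51Ident
import Summits.Ventures.PercRepro2.Tail2DEig42Ident
import Summits.Ventures.PercRepro2.Tail2DEig50IdentZ
import Summits.Ventures.PercRepro2.Tail2DEig41IdentZ
import Summits.Ventures.PercRepro2.Tail2DEig40IdentZ
import Summits.Ventures.PercRepro2.Tail2DEig31IdentZ
import Summits.Ventures.PercRepro2.Tail2DEig30IdentZ

/-!
# (SD) at EVERY clipped position on eight identical flow-one factors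
(seat mine-b, cell pub-perc-repro2; conjectures/MINE-B.md §45)

The red-heavy positions `(3,0)`, `(4,0)`, `(5,0)`, `(6,0)`, `(3,1)`, `(4,1)`, `(5,1)`, `(4,2)` by the explicit
one-change tables (`Tail2DEig*Ident*`), `(2,0)` and `(1,1)` by the one-factor relay of `Tail2DRelay20Comb.lean`
(no table exists there with non-negative coefficients up to degree 13, §44.16), the blue-heavy ones by the
colour swap, the rest by the top / sub-top / diagonal / axis theorems and the empty tails.
-/

namespace Summit.Ventures.PercRepro2.Tail2D

open V2Closure Finset

namespace Eight

variable {Y : V2Closure.SP}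

/-- `(1,2)` by the colour swap -/
theorem sdomZ_eight_12 (hY : FlowOne Y) (hR : 0 < (rSet Y).card) : SDomZ (parFin 8 (fun _ => Y)) 1 2 := by
  have h := IdentEig30.sdomZ_ident_Eig30 hY hR
  rw [sdomZ_swap_iff] at h
  norm_num at h
  exact h

/-- `(1,3)` by the colour swap -/
theorem sdomZ_eight_13 (hY : FlowOne Y) (hR : 0 < (rSet Y).card) : SDomZ (parFin 8 (fun _ => Y)) 1 3 := by
  have h := IdentEig40.sdomZ_ident_Eig40 hY hR
  rw [sdomZ_swap_iff] at h
  norm_num at h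
  exact h

/-- `(1,4)` by the colour swap -/
theorem sdomZ_eight_14 (hY : FlowOne Y) (hR : 0 < (rSet Y).card) : SDomZ (parFin 8 (fun _ => Y)) 1 4 := by
  have h := IdentEig50.sdomZ_ident_Eig50 hY hR
  rw [sdomZ_swap_iff] at h
  norm_num at h
  exact h

/-- `(1,5)` by the colour swap -/
theorem sdomZ_eight_15 (hY : FlowOne Y) (hR : 0 < (rSet Y).card) : SDomZ (parFin 8 (fun _ => Y)) 1 5 := by
  have h := IdentEig60.sdomZ_ident_Eig60 hY hR
  rw [sdomZ_swap_iff] at h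
  norm_num at h
  exact h

/-- `(2,2)` by the colour swap -/
theorem sdomZ_eight_22 (hY : FlowOne Y) (hR : 0 < (rSet Y).card) : SDomZ (parFin 8 (fun _ => Y)) 2 2 := by
  have h := IdentEig31.sdomZ_ident_Eig31 hY hR
  rw [sdomZ_swap_iff] at h
  norm_num at h
  exact h

/-- `(2,3)` by the colour swap -/
theorem sdomZ_eight_23 (hY : FlowOne Y) (hR : 0 < (rSet Y).card) : SDomZ (parFin 8 (fun _ => Y)) 2 3 := by
  have h := IdentEig41.sdomZ_ident_Eig41 hY hR
  rw [sdomZ_swap_iff] at h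
  norm_num at h
  exact h

/-- `(2,4)` by the colour swap -/
theorem sdomZ_eight_24 (hY : FlowOne Y) (hR : 0 < (rSet Y).card) : SDomZ (parFin 8 (fun _ => Y)) 2 4 := by
  have h := IdentEig51.sdomZ_ident_Eig51 hY hR
  rw [sdomZ_swap_iff] at h
  norm_num at h
  exact h

/-- `(3,3)` by the colour swap -/
theorem sdomZ_eight_33 (hY : FlowOne Y) (hR : 0 < (rSet Y).card) : SDomZ (parFin 8 (fun _ => Y)) 3 3 := by
  have h := IdentEig42.sdomZ_ident_Eig42 hY hR
  rw [sdomZ_swap_iff] at h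
  norm_num at h
  exact h

/-- **(SD) at EVERY clipped position on eight copies of `Y`** for any flow-one `Y` with a red crossing -/
theorem sdomZ_eight_all (hY : FlowOne Y) (hR : 0 < (rSet Y).card) (u v : ℤ) :
    SDomZ (parFin 8 (fun _ => Y)) u v := by
  have hX : ∀ i : Fin 8, FlowOne ((fun _ => Y) i) := fun _ => hY
  have hR' : ∀ i : Fin 8, 0 < (rSet ((fun _ => Y) i)).card := fun _ => hR
  by_cases haxis : u ≤ 0 ∨ v ≤ -1
  · exact sdomZ_axisComb_axis (axisComb_parFin 8 (fun _ => Y) (fun _ => ⟨hY, hR⟩)) u v haxis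
  push Not at haxis
  obtain ⟨u', rfl⟩ : ∃ u' : ℕ, u = u' := ⟨u.toNat, by omega⟩
  obtain ⟨v', rfl⟩ : ∃ v' : ℕ, v = v' := ⟨v.toNat, by omega⟩
  have hu : 1 ≤ u' := by omega
  by_cases hbig : 8 < u' + v'
  · apply sdomZ_of_tailCount_zero
    left
    rw [show ((u' : ℤ)).toNat = u' by omega, show ((v' : ℤ)).toNat = v' by omega]
    exact tailCount_parFin_eq_zero 8 _ hX u' v' hbig
  push Not at hbig
  have hu8 : u' ≤ 8 := by omega
  have hv8 : v' ≤ 8 := by omega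
  interval_cases u' <;> interval_cases v'
  · have := sdomZ_parFin_diag 8 (fun _ => Y) 1 hX (by norm_num)
    push_cast at this
    simpa using this
  · exact sdomZ_parFin_11 8 (fun _ => Y) hX hR'
  · exact sdomZ_eight_12 hY hR
  · exact sdomZ_eight_13 hY hR
  · exact sdomZ_eight_14 hY hR
  · exact sdomZ_eight_15 hY hR
  · exact sdomZ_parFin_subtop_all 8 (fun _ => Y) 1 6 hX hR' (by norm_num) (by norm_num)
  · have := sdomZ_parFin_top 8 (fun _ => Y) 1 hX (by norm_num) (by norm_num)
    simpa using this
  · exact absurd hbig (by norm_num)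
  · exact sdomZ_parFin_20 8 (fun _ => Y) hX hR'
  · have := sdomZ_parFin_diag 8 (fun _ => Y) 2 hX (by norm_num)
    push_cast at this
    simpa using this
  · exact sdomZ_eight_22 hY hR
  · exact sdomZ_eight_23 hY hR
  · exact sdomZ_eight_24 hY hR
  · exact sdomZ_parFin_subtop_all 8 (fun _ => Y) 2 5 hX hR' (by norm_num) (by norm_num)
  · have := sdomZ_parFin_top 8 (fun _ => Y) 2 hX (by norm_num) (by norm_num)
    simpa using this
  · exact absurd hbig (by norm_num)
  · exact absurd hbig (by norm_num)
  · exact IdentEig30.sdomZ_ident_Eig30 hY hR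
  · exact IdentEig31.sdomZ_ident_Eig31 hY hR
  · have := sdomZ_parFin_diag 8 (fun _ => Y) 3 hX (by norm_num)
    push_cast at this
    simpa using this
  · exact sdomZ_eight_33 hY hR
  · exact sdomZ_parFin_subtop_all 8 (fun _ => Y) 3 4 hX hR' (by norm_num) (by norm_num)
  · have := sdomZ_parFin_top 8 (fun _ => Y) 3 hX (by norm_num) (by norm_num)
    simpa using this
  · exact absurd hbig (by norm_num)
  · exact absurd hbig (by norm_num)
  · exact absurd hbig (by norm_num)
  · exact IdentEig40.sdomZ_ident_Eig40 hY hR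
  · exact IdentEig41.sdomZ_ident_Eig41 hY hR
  · exact IdentEig42.sdomZ_ident_Eig42 hY hR
  · have := sdomZ_parFin_diag 8 (fun _ => Y) 4 hX (by norm_num)
    push_cast at this
    simpa using this
  · have := sdomZ_parFin_top 8 (fun _ => Y) 4 hX (by norm_num) (by norm_num)
    simpa using this
  · exact absurd hbig (by norm_num)
  · exact absurd hbig (by norm_num)
  · exact absurd hbig (by norm_num)
  · exact absurd hbig (by norm_num)
  · exact IdentEig50.sdomZ_ident_Eig50 hY hR
  · exact IdentEig51.sdomZ_ident_Eig51 hY hR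
  · exact sdomZ_parFin_subtop_all 8 (fun _ => Y) 5 2 hX hR' (by norm_num) (by norm_num)
  · have := sdomZ_parFin_top 8 (fun _ => Y) 5 hX (by norm_num) (by norm_num)
    simpa using this
  · exact absurd hbig (by norm_num)
  · exact absurd hbig (by norm_num)
  · exact absurd hbig (by norm_num)
  · exact absurd hbig (by norm_num)
  · exact absurd hbig (by norm_num)
  · exact IdentEig60.sdomZ_ident_Eig60 hY hR
  · exact sdomZ_parFin_subtop_all 8 (fun _ => Y) 6 1 hX hR' (by norm_num) (by norm_num)
  · have := sdomZ_parFin_top 8 (fun _ => Y) 6 hX (by norm_num) (by norm_num)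
    simpa using this
  · exact absurd hbig (by norm_num)
  · exact absurd hbig (by norm_num)
  · exact absurd hbig (by norm_num)
  · exact absurd hbig (by norm_num)
  · exact absurd hbig (by norm_num)
  · exact absurd hbig (by norm_num)
  · exact sdomZ_parFin_subtop_all 8 (fun _ => Y) 7 0 hX hR' (by norm_num) (by norm_num)
  · have := sdomZ_parFin_top 8 (fun _ => Y) 7 hX (by norm_num) (by norm_num)
    simpa using this
  · exact absurd hbig (by norm_num)
  · exact absurd hbig (by norm_num)
  · exact absurd hbig (by norm_num)
  · exact absurd hbig (by norm_num)
  · exact absurd hbig (by norm_num)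
  · exact absurd hbig (by norm_num)
  · exact absurd hbig (by norm_num)
  · have := sdomZ_parFin_top 8 (fun _ => Y) 8 hX (by norm_num) (by norm_num)
    simpa using this
  · exact absurd hbig (by norm_num)
  · exact absurd hbig (by norm_num)
  · exact absurd hbig (by norm_num)
  · exact absurd hbig (by norm_num)
  · exact absurd hbig (by norm_num)
  · exact absurd hbig (by norm_num)
  · exact absurd hbig (by norm_num)
  · exact absurd hbig (by norm_num)

end Eight

end Summit.Ventures.PercRepro2.Tail2D
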